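import Literature.NumberTheory.Transcendental.ZeroEstDerivatives
import Literature.NumberTheory.Transcendental.TwoVarJets
import HarnessLib

/-!
# Zero estimates on commutative algebraic groups, VI: derivatives of translated forms (Philippon's `F`)

Topic `Literature/NumberTheory/Transcendental`. Sixth module of the discharge of
`Literature.NumberTheory.Transcendental.philippon1986_std` through D. Roy's exposition of
Philippon's zero estimate (Nesterenko–Philippon (eds.), LNM 1752, Ch. 11) for an abstract analytic
group model `M : AnalyticGroupModel V N`. Roy's Prop. 3.6 (iv) identifies the ideals `∂^T_Σ(I)`
with the special closure of Philippon's set of forms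
`F = { ∂^κ/∂z^κ P(A(X, ψ_σ(z)))|_{z=0} }` — derivatives IN THE PARAMETER `z` of the addition law
specialised at the moving point `σ + Φ(z)`, which keep the degree `c·D` in `X` (p. 212). This file
constructs these forms and computes their functions, using of the addition laws only that the
translates `translForm α v P` are forms of degree `c·D` whose coefficients are entire functions
of `v` (`AnalyticGroupModel.coeffDifferentiable_translForm`; second version of this module — the
first went through the polynomial dependence of the laws on the second argument, which the theta
model of `M_κ` (`PkappaThetaAdditionPoly.lean`) does not provide):

* **`M.derivForm α c x k P = ∑_{|m| = c·deg P} (d^k/dt^k coeff_m(translForm α (c + tx) P)|₀) X^m`**,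
  a form of degree `c·D` (`isHomogeneous_derivForm`) with
  **`F_{derivForm}(w) = d^k/dt^k [λ^α(w, c+tx)^D F_P(w + c + tx)]|₀`** (`F_derivForm`);
* **Roy's Lemma 3.3 for orders** (`vanishesToOrder_deriv_transl`, `VanishesToOrder.derivForm`):
  if `F_P` vanishes to order `K` along `W` at `b + c` and `x ∈ W`, `k < K`, then
  `w ↦ d^k/dt^k [g(w,t) F_P(w + c + tx)]|₀` (any entire `g`), in particular `F_{derivForm α c x k P}`,
  vanishes to order `K - k` along `W` at `b` — mixed jets of an analytic function of
  `(w, t) ∈ V × ℂ` through the tree's `iteratedDeriv_iteratedDeriv_line_eq_zero`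
  (`TwoVarJets.lean`), no Leibniz formula needed; and the converse at good laws
  (`vanishesToOrder_iff_F_derivForm`).

Everything is PROVED.

## References

* Yu. V. Nesterenko, P. Philippon (eds.), *Introduction to Algebraic Independence Theory*,
  LNM 1752, Springer 2001, Ch. 11 (D. Roy), Prop. 3.6 (iv) and its proof (p. 212), Lemma 3.3.
  [NesterenkoPhilippon2001]
* P. Philippon, *Lemmes de zéros dans les groupes algébriques commutatifs*, Bull. Soc. Math.
  France 114 (1986), 355–383, Déf. 4.2 (the set `F`). [Philippon1986]
-/

noncomputable section

open MvPolynomial Set Filter Topology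
open scoped Pointwise ContDiff

namespace Literature.NumberTheory.Transcendental

namespace AnalyticGroupModel

variable {V : Type*} [NormedAddCommGroup V] [NormedSpace ℂ V] {N : ℕ} (M : AnalyticGroupModel V N)

attribute [local instance] MvPolynomial.gradedAlgebra

/-! ### Supports of forms -/

omit M in
/-- The support of a form of degree `e` consists of exponents of degree `e`. [folklore] -/
theorem support_subset_finsuppAntidiag {Q : MvPolynomial (Fin (N + 1)) ℂ} {e : ℕ} (hQ : Q.IsHomogeneous e) :
    Q.support ⊆ (Finset.univ : Finset (Fin (N + 1))).finsuppAntidiag e := by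
  classical
  intro d hd
  rw [Finset.mem_finsuppAntidiag]
  refine ⟨?_, fun i _ => Finset.mem_univ i⟩
  have h := hQ (mem_support_iff.mp hd)
  rw [← Finset.sum_subset (Finset.subset_univ d.support)
    (fun i _ hi => Finsupp.notMem_support_iff.mp hi)]
  simpa [Finsupp.weight_apply, Finsupp.sum] using h

omit M in
/-- A form as a sum over the exponents of its degree. [folklore] -/
theorem eq_sum_monomial_of_isHomogeneous {Q : MvPolynomial (Fin (N + 1)) ℂ} {e : ℕ} (hQ : Q.IsHomogeneous e) :
    Q = ∑ m ∈ (Finset.univ : Finset (Fin (N + 1))).finsuppAntidiag e, monomial m (Q.coeff m) := by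
  classical
  conv_lhs => rw [Q.as_sum]
  exact Finset.sum_subset (support_subset_finsuppAntidiag hQ) fun m _ hm => by
    rw [notMem_support_iff.mp hm, monomial_zero]

omit M in
/-- Members of `finsuppAntidiag e` have degree `e`. [folklore] -/
theorem degree_eq_of_mem_finsuppAntidiag {m : Fin (N + 1) →₀ ℕ} {e : ℕ}
    (hm : m ∈ (Finset.univ : Finset (Fin (N + 1))).finsuppAntidiag e) : m.degree = e := by
  classical
  rw [Finset.mem_finsuppAntidiag] at hm
  rw [← hm.1]
  unfold Finsupp.degree
  exact (Finset.sum_subset (Finset.subset_univ m.support)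
    (fun i _ hi => Finsupp.notMem_support_iff.mp hi))

/-! ### The derived forms -/

/-- The coefficient functions of the translates along a line are entire, hence smooth. [folklore] -/
theorem contDiff_coeff_translForm_line (α : Fin M.nLaw) (P : MvPolynomial (Fin (N + 1)) ℂ)
    (m : Fin (N + 1) →₀ ℕ) (c x : V) {n : WithTop ℕ∞} :
    ContDiff ℂ n fun t : ℂ => coeff m (M.translForm α (c + t • x) P) := by
  have hd : Differentiable ℂ fun t : ℂ => coeff m (M.translForm α (c + t • x) P) :=
    (M.coeffDifferentiable_translForm α P m).comp ((differentiable_const c).add (differentiable_id.smul_const x))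
  exact hd.contDiff.of_le le_top

/-- **The derived form `∂_t^k translForm α (c + tx) P |_{t=0}`** (Philippon's `F`, Roy p. 212):
coefficientwise `k`-th derivative at `t = 0`, summed over the exponents of degree `c · deg P`.
[cite: NesterenkoPhilippon2001, Ch. 11 Prop. 3.6 (iv)] -/
def derivForm (α : Fin M.nLaw) (c x : V) (k : ℕ) (P : MvPolynomial (Fin (N + 1)) ℂ) :
    MvPolynomial (Fin (N + 1)) ℂ :=
  ∑ m ∈ (Finset.univ : Finset (Fin (N + 1))).finsuppAntidiag (M.lawDeg * P.totalDegree),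
    monomial m (iteratedDeriv k (fun t : ℂ => coeff m (M.translForm α (c + t • x) P)) 0)

/-- **The derived forms keep the degree `c·D`.** [cite: NesterenkoPhilippon2001, Ch. 11 Prop. 3.6 (iv)] -/
theorem isHomogeneous_derivForm (α : Fin M.nLaw) (c x : V) (k : ℕ) {P : MvPolynomial (Fin (N + 1)) ℂ}
    {D : ℕ} (hP : P.IsHomogeneous D) : (M.derivForm α c x k P).IsHomogeneous (M.lawDeg * D) := by
  classical
  by_cases hP0 : P = 0
  · subst hP0
    have : M.derivForm α c x k 0 = 0 := by
      unfold derivForm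
      refine Finset.sum_eq_zero fun m _ => ?_
      have h0 : (fun t : ℂ => coeff m (M.translForm α (c + t • x) 0)) = 0 := by
        funext t; simp [translForm]
      rw [h0, iteratedDeriv_const_zero, monomial_zero]
    rw [this]
    exact isHomogeneous_zero _ _ _
  · have hdeg : P.totalDegree = D := hP.totalDegree hP0
    unfold derivForm
    rw [hdeg]
    refine IsHomogeneous.sum _ _ _ fun m hm => ?_
    exact isHomogeneous_monomial _ (degree_eq_of_mem_finsuppAntidiag hm)

omit M in
/-- Iterated derivatives of finite sums of smooth functions. [folklore] -/
theorem iteratedDeriv_finset_sum {ι : Type*} (s : Finset ι) {f : ι → ℂ → ℂ} {k : ℕ} {x : ℂ}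
    (hf : ∀ i ∈ s, ContDiffAt ℂ k (f i) x) :
    iteratedDeriv k (fun t => ∑ i ∈ s, f i t) x = ∑ i ∈ s, iteratedDeriv k (f i) x := by
  classical
  induction s using Finset.induction_on with
  | empty =>
    simp only [Finset.sum_empty]
    rw [show (fun _ : ℂ => (0 : ℂ)) = 0 from rfl, iteratedDeriv_const_zero]
  | insert i s hi ih =>
    simp only [Finset.sum_insert hi]
    have h1 : ContDiffAt ℂ k (f i) x := hf i (Finset.mem_insert_self i s)
    have h2 : ContDiffAt ℂ k (fun t => ∑ j ∈ s, f j t) x :=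
      ContDiffAt.sum fun j hj => hf j (Finset.mem_insert_of_mem hj)
    have := iteratedDeriv_add h1 h2
    rw [show (fun t => f i t + ∑ j ∈ s, f j t) = f i + fun t => ∑ j ∈ s, f j t from rfl, this,
      ih fun j hj => hf j (Finset.mem_insert_of_mem hj)]

/-- **The function of a derived form**:
`F_{derivForm α c x k P}(w) = d^k/dt^k [λ^α(w, c + tx)^D F_P(w + (c + tx))]|₀`.
[cite: NesterenkoPhilippon2001, Ch. 11 Prop. 3.6 (iv) (proof)] -/
theorem F_derivForm (α : Fin M.nLaw) (c x : V) (k : ℕ) {P : MvPolynomial (Fin (N + 1)) ℂ} {D : ℕ}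
    (hP : P.IsHomogeneous D) (w : V) :
    M.F (M.derivForm α c x k P) w =
      iteratedDeriv k (fun t : ℂ => M.lam α w (c + t • x) ^ D * M.F P (w + (c + t • x))) 0 := by
  classical
  by_cases hP0 : P = 0
  · subst hP0
    have h1 : M.derivForm α c x k 0 = 0 := by
      unfold derivForm
      refine Finset.sum_eq_zero fun m _ => ?_
      have h0 : (fun t : ℂ => coeff m (M.translForm α (c + t • x) 0)) = 0 := by
        funext t; simp [translForm]
      rw [h0, iteratedDeriv_const_zero, monomial_zero]
    rw [h1, F_zero]
    have : (fun t : ℂ => M.lam α w (c + t • x) ^ D * M.F 0 (w + (c + t • x))) = 0 := by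
      funext t; simp [F]
    rw [this, iteratedDeriv_const_zero]
  have hdeg : P.totalDegree = D := hP.totalDegree hP0
  set S := (Finset.univ : Finset (Fin (N + 1))).finsuppAntidiag (M.lawDeg * D) with hS
  -- `F` of the derived form as a sum over `S`
  have hF : M.F (M.derivForm α c x k P) w =
      ∑ m ∈ S, iteratedDeriv k (fun t : ℂ => coeff m (M.translForm α (c + t • x) P)) 0 *
        (m.prod fun i e => M.pt w i ^ e) := by
    unfold derivForm
    rw [hdeg, ← hS, F, map_sum]
    exact Finset.sum_congr rfl fun m _ => by rw [eval_monomial]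
  rw [hF]
  -- pull the sum inside the derivative
  have hterm : ∀ m ∈ S, iteratedDeriv k (fun t : ℂ => coeff m (M.translForm α (c + t • x) P)) 0 *
      (m.prod fun i e => M.pt w i ^ e) =
        iteratedDeriv k (fun t : ℂ => coeff m (M.translForm α (c + t • x) P) * (m.prod fun i e => M.pt w i ^ e)) 0 := by
    intro m _
    rw [iteratedDeriv_mul_const_field]
  rw [Finset.sum_congr rfl hterm, ← iteratedDeriv_finset_sum]
  · congr 1
    funext t
    -- `∑_{m ∈ S} coeff_m(translForm α v P) Θ(w)^m = F_{translForm α v P}(w) = λ^D F_P(w + v)`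
    rw [← M.F_translForm α (c + t • x) hP w, F]
    conv_rhs => rw [eq_sum_monomial_of_isHomogeneous (M.isHomogeneous_translForm α (c + t • x) hP), map_sum]
    exact Finset.sum_congr rfl fun m _ => by rw [eval_monomial]
  · intro m _
    exact ((M.contDiff_coeff_translForm_line α P m c x).mul contDiff_const).contDiffAt

/-! ### Orders of derivatives of translates (Roy Lemma 3.3) -/

/-- **Roy's Lemma 3.3, in terms of orders.** If `F_P` vanishes to order `K` along `W` at `b + c`,
`x ∈ W` and `k < K`, then for every entire `g` on `V × ℂ` the function
`w ↦ d^k/dt^k [g(w,t) F_P(w + (c + tx))]|₀` vanishes to order `K - k` along `W` at `b`.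
[cite: NesterenkoPhilippon2001, Ch. 11 Lemma 3.3] -/
theorem vanishesToOrder_deriv_transl {W : Submodule ℂ V} {P : MvPolynomial (Fin (N + 1)) ℂ}
    {b c x : V} (hx : x ∈ W) {K k : ℕ} (hk : k < K) (hP : VanishesToOrder W (M.F P) (b + c) K)
    {g : V × ℂ → ℂ} (hg : AnalyticOnNhd ℂ g univ) :
    VanishesToOrder W (fun w => iteratedDeriv k (fun t : ℂ => g (w, t) * M.F P (w + (c + t • x))) 0) b (K - k) := by
  -- the entire function `f̃(w, τ) = g(w, τ) F_P(w + c + τ x)` on `E = V × ℂ`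
  set f : V × ℂ → ℂ := fun p => g p * M.F P (p.1 + (c + p.2 • x)) with hf
  have hfan : AnalyticOnNhd ℂ f univ := by
    refine hg.mul ?_
    have h1 : AnalyticOnNhd ℂ (fun p : V × ℂ => p.1 + (c + p.2 • x)) univ :=
      analyticOnNhd_fst.add (analyticOnNhd_const.add (analyticOnNhd_snd.smul analyticOnNhd_const))
    exact (M.analyticOnNhd_F P).comp h1 (mapsTo_univ _ _)
  have hfcd : ContDiff ℂ ω f := hfan.contDiff
  -- line jets of `f` at `(b, 0)` along `U' = W × ℂ` vanish to order `K`
  set U' : Submodule ℂ (V × ℂ) := W.prod ⊤ with hU'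
  have hjets : ∀ d ∈ U', ∀ j < K, iteratedDeriv j (fun r : ℂ => f ((b, 0) + r • d)) 0 = 0 := by
    rintro ⟨y', τ'⟩ hd j hj
    have hy' : y' ∈ W := (Submodule.mem_prod.mp hd).1
    have hdir : y' + τ' • x ∈ W := W.add_mem hy' (W.smul_mem τ' hx)
    -- `f((b,0) + r (y', τ')) = g(b + r y', r τ') · F_P((b + c) + r (y' + τ' x))`
    have heq : (fun r : ℂ => f ((b, 0) + r • (y', τ'))) =
        fun r : ℂ => g (b + r • y', r * τ') * M.F P ((b + c) + r • (y' + τ' • x)) := by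
      funext r
      simp only [hf, Prod.smul_mk, Prod.mk_add_mk, zero_add, smul_eq_mul]
      congr 2
      rw [smul_add, smul_smul]
      abel
    rw [heq]
    have hgr : AnalyticAt ℂ (fun r : ℂ => g (b + r • y', r * τ')) 0 := by
      have : AnalyticAt ℂ (fun r : ℂ => ((b + r • y', r * τ') : V × ℂ)) 0 :=
        (analyticAt_const.add (analyticAt_id.smul analyticAt_const)).prod (analyticAt_id.mul analyticAt_const)
      exact (hg _ trivial).comp this
    exact forall_iteratedDeriv_mul_eq_zero (M.analyticAt_F_line P (b + c) (y' + τ' • x) 0) hgr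
      (hP _ hdir) j hj
  -- the mixed jets
  intro y hy j hj
  have h := iteratedDeriv_iteratedDeriv_line_eq_zero hfcd U' (b, 0) K hjets
    (v := (y, 0)) (x := (0, 1)) (Submodule.mem_prod.mpr ⟨hy, trivial⟩)
    (Submodule.mem_prod.mpr ⟨W.zero_mem, trivial⟩) (j := j) (k := k) (by omega)
  have heqf : (fun s : ℂ => (fun w => iteratedDeriv k (fun t : ℂ => g (w, t) * M.F P (w + (c + t • x))) 0) (b + s • y)) =
      fun s : ℂ => iteratedDeriv k (fun ξ : ℂ => f ((b, 0) + s • (y, 0) + ξ • (0, 1))) 0 := by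
    funext s
    simp only [hf, Prod.smul_mk, Prod.mk_add_mk, smul_zero, add_zero, zero_add, smul_eq_mul, mul_one, mul_zero]
  rw [← heqf] at h
  exact h

/-- **Derived forms lower the order by at most the number of derivatives**: if `F_P` vanishes to
order `K` along `W` at `b + c`, `x ∈ W`, `k < K`, then `F_{derivForm α c x k P}` vanishes to order
`K - k` along `W` at `b`. [cite: NesterenkoPhilippon2001, Ch. 11 Lemma 3.3, Prop. 3.6 (ii)–(iii)] -/
theorem VanishesToOrder.derivForm {W : Submodule ℂ V} {P : MvPolynomial (Fin (N + 1)) ℂ} {D : ℕ}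
    (hPh : P.IsHomogeneous D) {b c x : V} (hx : x ∈ W) {K k : ℕ} (hk : k < K)
    (hP : VanishesToOrder W (M.F P) (b + c) K) (α : Fin M.nLaw) :
    VanishesToOrder W (M.F (M.derivForm α c x k P)) b (K - k) := by
  have heq : M.F (M.derivForm α c x k P) =
      fun w => iteratedDeriv k (fun t : ℂ => (fun p : V × ℂ => M.lam α p.1 (c + p.2 • x) ^ D) (w, t) *
        M.F P (w + (c + t • x))) 0 := by
    funext w
    exact M.F_derivForm α c x k hPh w
  rw [heq]
  refine M.vanishesToOrder_deriv_transl (g := fun p : V × ℂ => M.lam α p.1 (c + p.2 • x) ^ D) hx hk hP ?_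
  have h1 : AnalyticOnNhd ℂ (fun p : V × ℂ => ((p.1, c + p.2 • x) : V × V)) univ :=
    analyticOnNhd_fst.prod (analyticOnNhd_const.add (analyticOnNhd_snd.smul analyticOnNhd_const))
  exact ((M.analyticOnNhd_lam α).comp h1 (mapsTo_univ _ _)).pow D

/-- **Derived forms at good laws see the order exactly**: if `λ^α(b, c) ≠ 0` then `F_P` vanishes to
order `K` along `W` at `b + c` iff all `F_{derivForm α c x k P}(b)`, `x ∈ W`, `k < K`, vanish.
[cite: NesterenkoPhilippon2001, Ch. 11 Prop. 3.6 (iii)] -/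
theorem vanishesToOrder_iff_F_derivForm {W : Submodule ℂ V} {P : MvPolynomial (Fin (N + 1)) ℂ} {D : ℕ}
    (hPh : P.IsHomogeneous D) {b c : V} {α : Fin M.nLaw} (hα : M.lam α b c ≠ 0) (K : ℕ) :
    VanishesToOrder W (M.F P) (b + c) K ↔ ∀ x ∈ W, ∀ k < K, M.F (M.derivForm α c x k P) b = 0 := by
  refine forall₂_congr fun x hx => ?_
  -- one-variable order transfer through the unit `t ↦ λ^α(b, c + tx)^D`
  have hg : AnalyticAt ℂ (fun t : ℂ => M.lam α b (c + t • x) ^ D) 0 := by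
    have h1 : AnalyticAt ℂ (fun t : ℂ => ((b, c + t • x) : V × V)) 0 :=
      analyticAt_const.prod (analyticAt_const.add (analyticAt_id.smul analyticAt_const))
    exact (((M.analyticOnNhd_lam α) _ trivial).comp h1).pow D
  have hg0 : (fun t : ℂ => M.lam α b (c + t • x) ^ D) 0 ≠ 0 := by simpa using pow_ne_zero D hα
  have hf : AnalyticAt ℂ (fun t : ℂ => M.F P (b + (c + t • x))) 0 := by
    have := M.analyticAt_F_line P (b + c) x 0
    simpa [add_assoc] using this
  have key := forall_iteratedDeriv_mul_eq_zero_iff_of_ne_zero hf hg hg0 K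
  simp only [M.F_derivForm α c x _ hPh]
  rw [key]
  simp [add_assoc]

end AnalyticGroupModel

end Literature.NumberTheory.Transcendental
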